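import Mathlib
import HarnessLib
import Literature.Analysis.FluidPDE.SpaceTimeCalculus
import Literature.Analysis.FluidPDE.WeakSolution
import Summits.NavierStokesRegularity.NavierStokesRegularity.Theorems.ChiralWindowDoorDefs
import Summits.NavierStokesRegularity.NavierStokesRegularity.Theorems.CriticalFluxDoorDefs
import Summits.NavierStokesRegularity.NavierStokesRegularity.Theorems.RellichScarDefs
import Summits.NavierStokesRegularity.NavierStokesRegularity.Theorems.ChiralWindowDoorLambda
import Summits.NavierStokesRegularity.NavierStokesRegularity.Theorems.CriticalFluxDoorLambdaDeriv
import Summits.NavierStokesRegularity.NavierStokesRegularity.Theorems.CriticalFluxDoorTimeDeriv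

/-!
# Door S21-C «CriticalFluxDoor» — the windowed critical energy is DIFFERENTIABLE IN TIME:
# `d/dt Q(a, v(t)) = ∫ a (⟪∂ₜv, Λv⟫ + ⟪v, Λ∂ₜv⟫)` (F3-DERIVATION §1, first line)

Door S21-C of nsreg-p1's local Type-I door family (`HOME/ns-regularity-ideate-p1/ROUND-20.md`; DESIGN-ONLY, route NOT born).
For a classical unit-viscosity solution `(v, q)` on the open backward time axis with the tree's scale-invariant package
`ScaleInvariantBounds v q` (`…RellichScarDefs`) and a `C²` weight `a` with compact support, the windowed critical energy
`Q(a, v(t)) = critEnergy a (v t) = ∫ a⟪v(t), Λv(t)⟫` (`…CriticalFluxDoorDefs`) is differentiable on `t < 0` with the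
expected derivative (Mathlib `hasDerivAt_integral_of_dominated_loc_of_deriv_le` on the `x`-integral; the `Λ`-factor is
differentiated in time by `…CriticalFluxDoorTimeDeriv.hasDerivAt_fracLapHalf_timeLine`; domination on the
time-neighbourhood `(2t, t/2)` by `|a| · const`).

* `slice_sup_bounds`, `timeDeriv_sup_bounds` — `x`-uniform bounds of orders `0…4` / `0…3` for the slices `v(s)`,
  `∂ₜv(s)`, UNIFORM on `(2t, t/2)`;
* `norm_fracLapHalf_le_integral_derivDom` — `‖Λg(x)‖ ≤ ½∫derivDom(M₁,M₃)` for a `C²` field with `‖g‖ ≤ M₁`, `‖D²g‖ ≤ M₃`;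
  `continuous_fracLapHalf_of_bounds` — `Λg` is continuous for a `C³` field with bounded `g, Dg, D²g, D³g`;
* `hasDerivAt_critEnergy` — **`d/dt Q(a, v(t)) = ∫ a(⟪∂ₜv(t), Λv(t)⟫ + ⟪v(t), Λ∂ₜv(t)⟫)`** on `t < 0`.

Seat nsreg-p6 g13 (THEOREMS-ONLY door sequels, DIRECTOR-NS g8 #32 (2)/#36).  WHAT THIS IS NOT: not NS regularity (Clay A);
not the budget F3 yet (the equation is inserted in `…CriticalFluxDoorCritEnergyIdentity`); no route is opened.
-/

noncomputable section

-- the summit and its single sub-problem share the name (CONVENTIONS §1), as in every Theorems file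
set_option linter.dupNamespace false

namespace Summit.NavierStokesRegularity.NavierStokesRegularity.Theorems.CriticalFluxDoorCritEnergyDeriv

open MeasureTheory Metric Set Filter Topology Function
open scoped RealInnerProductSpace
open Literature.Analysis Literature.Analysis.FluidPDE
open Summit.NavierStokesRegularity.NavierStokesRegularity.Theorems.ChiralWindowDoorDefs
open Summit.NavierStokesRegularity.NavierStokesRegularity.Theorems.CriticalFluxDoorDefs
open Summit.NavierStokesRegularity.NavierStokesRegularity.Theorems.RellichScarScarRigidity (ScaleInvariantBounds)
open Summit.NavierStokesRegularity.NavierStokesRegularity.Theorems.ChiralWindowDoorLambda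
  (integrable_fracLapHalf_integrand_of_contDiff)
open Summit.NavierStokesRegularity.NavierStokesRegularity.Theorems.CriticalFluxDoorLambdaDeriv
  (integrable_derivDom norm_integrand_le_derivDom hasFDerivAt_fracLapHalf)
open Summit.NavierStokesRegularity.NavierStokesRegularity.Theorems.CriticalFluxDoorTimeDeriv
  (hasDerivAt_timeLine contDiff_timeDeriv exists_timeDeriv_bound unif_of_scaleInvariant hasDerivAt_fracLapHalf_timeLine)

variable {v : ℝ → EuclideanSpace ℝ (Fin 3) → EuclideanSpace ℝ (Fin 3)} {q : ℝ → EuclideanSpace ℝ (Fin 3) → ℝ}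

/-! ### `x`-uniform bounds for the slices, uniform on a time-neighbourhood -/

/-- **Uniform bounds of orders `0…4` for the slices `v(s)`, `s ∈ (2t, t/2)`**, from the scale-invariant package. -/
theorem slice_sup_bounds (hSIB : ScaleInvariantBounds v q) {t : ℝ} (ht : t < 0) :
    ∃ M : ℕ → ℝ, ∀ n ≤ 4, ∀ s ∈ Ioo (2 * t) (t / 2), ∀ y : EuclideanSpace ℝ (Fin 3),
      ‖iteratedFDeriv ℝ n (v s) y‖ ≤ M n := by
  choose L hL using hSIB
  refine ⟨fun n => |L n| / Real.sqrt (-(t / 2)) ^ (1 + n), fun n _ s hs y => ?_⟩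
  exact unif_of_scaleInvariant (g := fun s y => ‖iteratedFDeriv ℝ n (v s) y‖) ht (fun s hs y => (hL n s hs y).1) hs y

/-- **Uniform bounds of orders `0…3` for the slices `∂ₜv(s)`, `s ∈ (2t, t/2)`.** -/
theorem timeDeriv_sup_bounds (hsol : IsClassicalNSSolutionOn (Iio (0 : ℝ)) 1 0 v q) (hSIB : ScaleInvariantBounds v q)
    {t : ℝ} (ht : t < 0) :
    ∃ N : ℕ → ℝ, ∀ n ≤ 3, ∀ s ∈ Ioo (2 * t) (t / 2), ∀ y : EuclideanSpace ℝ (Fin 3),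
      ‖iteratedFDeriv ℝ n (timeDeriv v s) y‖ ≤ N n := by
  have h := fun n => exists_timeDeriv_bound hsol hSIB n
  choose W hW using h
  refine ⟨fun n => |W n| / Real.sqrt (-(t / 2)) ^ (3 + n), fun n _ s hs y => ?_⟩
  exact unif_of_scaleInvariant (g := fun s y => ‖iteratedFDeriv ℝ n (timeDeriv v s) y‖) ht (hW n) hs y

/-! ### `Λ` of a bounded `C²`/`C³` field: sup bound and continuity -/

/-- **`‖Λg(x)‖ ≤ ½ ∫ derivDom(M₁, M₃)`** for a `C²` field with `‖g‖ ≤ M₁`, `‖D²g‖ ≤ M₃` (the `x`-uniform majorant). -/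
theorem norm_fracLapHalf_le_integral_derivDom {g : EuclideanSpace ℝ (Fin 3) → EuclideanSpace ℝ (Fin 3)}
    (hg : ContDiff ℝ 2 g) {M₁ M₃ : ℝ} (h1 : ∀ y, ‖g y‖ ≤ M₁) (h3 : ∀ y, ‖iteratedFDeriv ℝ 2 g y‖ ≤ M₃)
    (x : EuclideanSpace ℝ (Fin 3)) :
    ‖fracLapHalf g x‖ ≤ (1 / 2 : ℝ) * ∫ z, derivDom M₁ M₃ z := by
  unfold fracLapHalf
  rw [norm_smul, Real.norm_eq_abs, abs_of_pos (by norm_num : (0 : ℝ) < 1 / 2)]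
  gcongr
  exact norm_integral_le_of_norm_le (integrable_derivDom M₁ M₃)
    (ae_of_all _ fun z => norm_integrand_le_derivDom hg h1 h3 x z)

/-- `Λg` is continuous for a `C³` field with bounded `g, Dg, D²g, D³g` (it is differentiable, by E6). -/
theorem continuous_fracLapHalf_of_bounds {g : EuclideanSpace ℝ (Fin 3) → EuclideanSpace ℝ (Fin 3)}
    (hg : ContDiff ℝ 3 g) {M₀ M₁ M₂ M₃ : ℝ} (h0 : ∀ y, ‖g y‖ ≤ M₀) (h1 : ∀ y, ‖fderiv ℝ g y‖ ≤ M₁)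
    (h2 : ∀ y, ‖iteratedFDeriv ℝ 2 g y‖ ≤ M₂) (h3 : ∀ y, ‖iteratedFDeriv ℝ 3 g y‖ ≤ M₃) :
    Continuous (fracLapHalf g) :=
  continuous_iff_continuousAt.2 fun x => (hasFDerivAt_fracLapHalf hg h0 h1 h2 h3 x).differentiableAt.continuousAt

/-! ### The time derivative of the windowed critical energy -/

/-- **`d/dt Q(a, v(t)) = ∫ a (⟪∂ₜv(t), Λv(t)⟫ + ⟪v(t), Λ∂ₜv(t)⟫)` on `t < 0`** for a classical unit-viscosity solution with
the scale-invariant package and a compactly supported `C²` weight. -/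
theorem hasDerivAt_critEnergy (hsol : IsClassicalNSSolutionOn (Iio (0 : ℝ)) 1 0 v q) (hSIB : ScaleInvariantBounds v q)
    {a : EuclideanSpace ℝ (Fin 3) → ℝ} (ha : Continuous a) (hac : HasCompactSupport a) {t : ℝ} (ht : t < 0) :
    HasDerivAt (fun s => critEnergy a (v s))
      (∫ x, a x * (⟪timeDeriv v t x, fracLapHalf (v t) x⟫ + ⟪v t x, fracLapHalf (timeDeriv v t) x⟫)) t := by
  -- the time neighbourhood and the uniform constants there
  have hI : Ioo (2 * t) (t / 2) ∈ 𝓝 t := Ioo_mem_nhds (by linarith) (by linarith)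
  have hIneg : ∀ s ∈ Ioo (2 * t) (t / 2), s < 0 := fun s hs => by linarith [hs.2]
  have htI : t ∈ Ioo (2 * t) (t / 2) := ⟨by linarith, by linarith⟩
  obtain ⟨M, hM⟩ := slice_sup_bounds hSIB ht
  obtain ⟨N, hN⟩ := timeDeriv_sup_bounds hsol hSIB ht
  -- regularity of the slices
  have hvC : ∀ s < (0 : ℝ), ContDiff ℝ 3 (v s) := fun s hs => contDiff_infty.1 (hsol.contDiff_velocity hs) 3
  have hwC : ∀ s < (0 : ℝ), ContDiff ℝ 3 (timeDeriv v s) := fun s hs => contDiff_timeDeriv hsol hs 3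
  have hM0 : ∀ s ∈ Ioo (2 * t) (t / 2), ∀ y, ‖v s y‖ ≤ M 0 := fun s hs y => by
    have h := hM 0 (by norm_num) s hs y; rwa [norm_iteratedFDeriv_zero] at h
  have hM1 : ∀ s ∈ Ioo (2 * t) (t / 2), ∀ y, ‖fderiv ℝ (v s) y‖ ≤ M 1 := fun s hs y => by
    have h := hM 1 (by norm_num) s hs y; rwa [norm_iteratedFDeriv_one] at h
  have hN0 : ∀ s ∈ Ioo (2 * t) (t / 2), ∀ y, ‖timeDeriv v s y‖ ≤ N 0 := fun s hs y => by
    have h := hN 0 (by norm_num) s hs y; rwa [norm_iteratedFDeriv_zero] at h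
  have hN1 : ∀ s ∈ Ioo (2 * t) (t / 2), ∀ y, ‖fderiv ℝ (timeDeriv v s) y‖ ≤ N 1 := fun s hs y => by
    have h := hN 1 (by norm_num) s hs y; rwa [norm_iteratedFDeriv_one] at h
  -- continuity of `Λv(s)`, `Λ∂ₜv(s)` for `s` in the neighbourhood
  have hΛvc : ∀ s ∈ Ioo (2 * t) (t / 2), Continuous (fracLapHalf (v s)) := fun s hs =>
    continuous_fracLapHalf_of_bounds (hvC s (hIneg s hs)) (hM0 s hs) (hM1 s hs) (hM 2 (by norm_num) s hs)
      (hM 3 (by norm_num) s hs)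
  have hΛwc : ∀ s ∈ Ioo (2 * t) (t / 2), Continuous (fracLapHalf (timeDeriv v s)) := fun s hs =>
    continuous_fracLapHalf_of_bounds (hwC s (hIneg s hs)) (hN0 s hs) (hN1 s hs) (hN 2 (by norm_num) s hs)
      (hN 3 (by norm_num) s hs)
  -- sup bounds of `Λv(s)`, `Λ∂ₜv(s)` on the neighbourhood
  set BΛv : ℝ := (1 / 2 : ℝ) * ∫ z, derivDom (M 0) (M 2) z with hBΛv
  set BΛw : ℝ := (1 / 2 : ℝ) * ∫ z, derivDom (N 0) (N 2) z with hBΛw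
  have hΛv : ∀ s ∈ Ioo (2 * t) (t / 2), ∀ y, ‖fracLapHalf (v s) y‖ ≤ BΛv := fun s hs y =>
    norm_fracLapHalf_le_integral_derivDom ((hvC s (hIneg s hs)).of_le (by norm_cast)) (hM0 s hs)
      (hM 2 (by norm_num) s hs) y
  have hΛw : ∀ s ∈ Ioo (2 * t) (t / 2), ∀ y, ‖fracLapHalf (timeDeriv v s) y‖ ≤ BΛw := fun s hs y =>
    norm_fracLapHalf_le_integral_derivDom ((hwC s (hIneg s hs)).of_le (by norm_cast)) (hN0 s hs)
      (hN 2 (by norm_num) s hs) y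
  -- the integrands
  set F : ℝ → EuclideanSpace ℝ (Fin 3) → ℝ := fun s x => a x * ⟪v s x, fracLapHalf (v s) x⟫ with hF
  set F' : ℝ → EuclideanSpace ℝ (Fin 3) → ℝ := fun s x =>
    a x * (⟪timeDeriv v s x, fracLapHalf (v s) x⟫ + ⟪v s x, fracLapHalf (timeDeriv v s) x⟫) with hF'
  have hvc : ∀ s < (0 : ℝ), Continuous (v s) := fun s hs => (hvC s hs).continuous
  have hwc : ∀ s < (0 : ℝ), Continuous (timeDeriv v s) := fun s hs => (hwC s hs).continuous
  have hFc : ∀ s ∈ Ioo (2 * t) (t / 2), Continuous (F s) := fun s hs =>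
    ha.mul ((hvc s (hIneg s hs)).inner (hΛvc s hs))
  have hF'c : ∀ s ∈ Ioo (2 * t) (t / 2), Continuous (F' s) := fun s hs =>
    ha.mul (((hwc s (hIneg s hs)).inner (hΛvc s hs)).add ((hvc s (hIneg s hs)).inner (hΛwc s hs)))
  have hFmeas : ∀ᶠ s in 𝓝 t, AEStronglyMeasurable (F s) volume := by
    filter_upwards [hI] with s hs using (hFc s hs).aestronglyMeasurable
  have hFint : Integrable (F t) := (hFc t htI).integrable_of_hasCompactSupport hac.mul_right
  have hF'meas : AEStronglyMeasurable (F' t) volume := (hF'c t htI).aestronglyMeasurable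
  -- domination by `|a| · K`
  set K : ℝ := N 0 * BΛv + M 0 * BΛw with hK
  have hdom : ∀ᵐ x ∂(volume : Measure (EuclideanSpace ℝ (Fin 3))), ∀ s ∈ Ioo (2 * t) (t / 2),
      ‖F' s x‖ ≤ |a x| * K := by
    refine ae_of_all _ fun x s hs => ?_
    rw [hF']; dsimp only
    rw [Real.norm_eq_abs, abs_mul]
    refine mul_le_mul_of_nonneg_left ?_ (abs_nonneg _)
    calc |⟪timeDeriv v s x, fracLapHalf (v s) x⟫ + ⟪v s x, fracLapHalf (timeDeriv v s) x⟫|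
        ≤ |⟪timeDeriv v s x, fracLapHalf (v s) x⟫| + |⟪v s x, fracLapHalf (timeDeriv v s) x⟫| := abs_add_le _ _
      _ ≤ ‖timeDeriv v s x‖ * ‖fracLapHalf (v s) x‖ + ‖v s x‖ * ‖fracLapHalf (timeDeriv v s) x‖ :=
          add_le_add (abs_real_inner_le_norm _ _) (abs_real_inner_le_norm _ _)
      _ ≤ N 0 * BΛv + M 0 * BΛw := by
          have e1 := hN0 s hs x
          have e2 := hΛv s hs x
          have e3 := hM0 s hs x
          have e4 := hΛw s hs x
          have : 0 ≤ N 0 := (norm_nonneg _).trans e1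
          have : 0 ≤ M 0 := (norm_nonneg _).trans e3
          gcongr
  have hbound : Integrable (fun x => |a x| * K) := (ha.abs.mul continuous_const).integrable_of_hasCompactSupport
    (hac.norm.mul_right)
  -- pointwise derivative
  have hderiv : ∀ᵐ x ∂(volume : Measure (EuclideanSpace ℝ (Fin 3))), ∀ s ∈ Ioo (2 * t) (t / 2),
      HasDerivAt (fun r => F r x) (F' s x) s := by
    refine ae_of_all _ fun x s hs => ?_
    have hs0 : s < 0 := hIneg s hs
    have h1 : HasDerivAt (fun r => v r x) (timeDeriv v s x) s := hasDerivAt_timeLine hsol hs0 x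
    have h2 : HasDerivAt (fun r => fracLapHalf (v r) x) (fracLapHalf (timeDeriv v s) x) s :=
      hasDerivAt_fracLapHalf_timeLine hsol hSIB hs0 x
    have h := (h1.inner ℝ h2).const_mul (a x)
    rw [hF']
    refine h.congr_deriv ?_
    dsimp only
    ring
  have key := hasDerivAt_integral_of_dominated_loc_of_deriv_le hI hFmeas hFint hF'meas hdom hbound hderiv
  have h := key.2
  rw [hF'] at h
  exact h

end Summit.NavierStokesRegularity.NavierStokesRegularity.Theorems.CriticalFluxDoorCritEnergyDeriv

end
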